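import Summits.BirchSwinnertonDyer.BirchSwinnertonDyer.Theorems.DerivedKatoValuationDoorDerivedKatoDoorRung389a1P5
import Summits.BirchSwinnertonDyer.Rank1Residual.Supersingular.SurjSerreCertificateShape
import HarnessLib

/-!
# Route `DerivedKatoValuationDoor` — the DOOR at the rung cell `(389a1, 5)` is kernel-decided
# (crux `DerivedKatoDoor`, stmt-BirchSwinnertonDyer-23024; line `birth`, stub `stub_rung389a1_5`; companion of
# `DerivedKatoValuationDoorDerivedKatoDoorRung389a1P5.lean`)

Helper file (`--supports stmt-BirchSwinnertonDyer-23024 --as helper`); it closes nothing and BSD is not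
proved by it. The rung `stub_rung389a1_5` of the crux D-K₂ is stated UNDER the door hypothesis
`5 ≤ 5 ∧ IsOrdinaryAt E 5 ∧ ρ̄_{E,5} onto` for `E = 389a1`. The companion file decided the first two
conjuncts; this file decides the third IN THE KERNEL — `ρ̄_{E,5} : Gal(ℚ̄/ℚ) ↠ GL₂(𝔽₅)` by Serre's
Prop. 19 with three Frobenius witnesses (`ℓ = 23, 3, 3`, point counts `#Ẽ(𝔽₂₃) = 28`, `#Ẽ(𝔽₃) = 6`),
through the tree's certificate shape `surj_of_ainvs_of_serreWitnesses` (x11c / b2b-bsdres) — so the door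
HOLDS (`door_389a1_five`, no hypothesis), the rung is a NON-VACUOUS instance of the crux's conclusion,
and critic price P-h of the route («ρ̄₅-onto certificate for 389a1») is paid by `decide`, not by a
citation. Consequence: the conditional rung of the companion file with the door DISCHARGED
(`firstDerivedKatoClass_389a1_five_of_sandwich`: sandwich + `Loc_5` + symbol DATA ⇒ `v_T(z₀) ≤ 1` for
every admissible Kato zeta class of `389a1` at `5`).

References: [Serre1972] §2.8 Prop. 19, §5.2 (iii); [CremonaAlgorithms1997] Table 1 (389A1);
[Kato2004Asterisque] Thm. 16.6; [BurnsKuriharaSano2019] Lemma 6.12–6.14.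
-/

set_option linter.dupNamespace false

noncomputable section

open scoped Classical

namespace Summit.BirchSwinnertonDyer.BirchSwinnertonDyer.Theorems.DerivedKatoValuationDoor

open Literature.NumberTheory.EllipticCurves Literature.NumberTheory.EllipticCurves.ModularForms
  Literature.NumberTheory.EllipticCurves.Kato2004 Literature.NumberTheory.GaloisRepresentations
  WeierstrassCurve CongruenceSubgroup
open Summit.BirchSwinnertonDyer.BirchSwinnertonDyer.Rank2Observatory
open Literature.NumberTheory.EllipticCurves.Kato2004.EulerSystemValues (tateRep)

/-! ## §1 The DOOR at `(389a1, 5)` is kernel-decided — `ρ̄_{E,5}` onto by three Serre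
witnesses (critic price P-h paid in the kernel), hence the rung's antecedent is TRUE (not vacuous) -/

/-- The atlas model of `389a1` IS the literal equation `[0, 1, 1, −2, 0]`. [cite: CremonaAlgorithms1997, Table 1 (389A1)] -/
theorem c389a1_baseChange_eq : c389a1.e.baseChange ℚ = (⟨0, 1, 1, -2, 0⟩ : WeierstrassCurve ℚ) := by
  rw [AtlasCurve.baseChange_e]
  ext <;> simp [Rank2Row.curve, c389a1]

/-- `#Ẽ(𝔽₃) = 6` for `389a1` (`a₃ = −2`), schema count. [folklore] -/
theorem countPoints_389a1_3 :
    Literature.NumberTheory.EllipticCurves.Rank1Residual.X11RankOneCertificates.countPoints [0, 1, 1, -2, 0] 3 = 6 := by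
  decide +kernel

/-- `#Ẽ(𝔽₂₃) = 28` for `389a1` (`a₂₃ = −4`), schema count. [folklore] -/
theorem countPoints_389a1_23 :
    Literature.NumberTheory.EllipticCurves.Rank1Residual.X11RankOneCertificates.countPoints [0, 1, 1, -2, 0] 23 = 28 := by
  decide +kernel

/-- **`ρ̄_{E,5} : Gal(ℚ̄/ℚ) → GL₂(𝔽₅)` is SURJECTIVE for `E = 389a1`**, kernel-decided by Serre's Prop. 19
with the witnesses (i) `ℓ₁ = 23`: `#Ẽ(𝔽₂₃) = 28`, `a = −4 ≢ 0`, `a² − 4ℓ₁ = −76 ≡ 4 = 2²` a non-zero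
square mod `5`; (ii) `ℓ₂ = 3`: `#Ẽ(𝔽₃) = 6`, `a = −2 ≢ 0`, `(a² − 4ℓ₂)² = 64 ≡ −1` (Euler: non-square);
(iii) `ℓ₃ = 3`: `a² = 4 ≡ 3·3`, `u = 3 ∉ {0,1,2,4}`, `u² − 3u + 1 = 1 ≢ 0` — via the tree's certificate
shape `surj_of_ainvs_of_serreWitnesses` (global minimality from the atlas, `isGloballyMinimal_389a1`).
This pays critic price P-h («ρ̄₅-onto certificate for 389a1 by `decide` or a citation») in the kernel.
[cite: Serre1972, §2.8 Prop. 19 and §5.2 (iii)] [cite: CremonaAlgorithms1997, Table 1 (389A1)] -/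
theorem hasSurjectiveModNGaloisRep_389a1_five : (c389a1.e.baseChange ℚ).HasSurjectiveModNGaloisRep 5 := by
  have hmin : (⟨0, 1, 1, -2, 0⟩ : WeierstrassCurve ℚ).IsGloballyMinimal :=
    c389a1_baseChange_eq ▸ isGloballyMinimal_389a1
  rw [c389a1_baseChange_eq]
  exact @Summit.BirchSwinnertonDyer.Rank1Residual.Supersingular.surj_of_ainvs_of_serreWitnesses
    0 1 1 (-2) 0 5 ⟨by norm_num⟩ (by norm_num) hmin
    23 3 3 (by norm_num) (by norm_num) (by norm_num) (by decide) (by decide) (by decide)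
    (by decide) (by decide) (by decide) (by decide +kernel) (by decide +kernel) (by decide +kernel)
    (n₁ := 28) (n₂ := 6) (n₃ := 6) countPoints_389a1_23 countPoints_389a1_3 countPoints_389a1_3
    (2 : ZMod 5) (3 : ZMod 5) (by decide +kernel) (by decide +kernel) (by decide +kernel)

/-- **`5` is a DOOR PRIME of `389a1`, unconditionally** (`5 ≤ 5`; good ordinary at `5`,
`isOrdinaryAt_389a1_five`; `ρ̄_{E,5}` onto, `hasSurjectiveModNGaloisRep_389a1_five`): the antecedent of the
rung `stub_rung389a1_5` HOLDS, so the rung is a genuine (non-vacuous) instance of the crux's conclusion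
at this cell. [cite: Serre1972, §2.8 Prop. 19] [cite: CremonaAlgorithms1997, Table 1 (389A1)] -/
theorem door_389a1_five [(c389a1.e.baseChange ℚ).IsGloballyMinimal] :
    5 ≤ 5 ∧ IsOrdinaryAt (c389a1.e.baseChange ℚ) 5 ∧
      (c389a1.e.baseChange ℚ).HasSurjectiveModNGaloisRep 5 :=
  door_389a1_five_of_surjective hasSurjectiveModNGaloisRep_389a1_five

/-- **The rung with the door DISCHARGED**: from the sandwich at `(389a1, 5)` (`hSand`, = the line's
`stub_sandwichFromDA` specialised; print), `Loc_5(389a1)` (`hLoc`) and the symbol DATA of the cell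
(`hdata`), EVERY admissible Kato zeta class `z₀` of `389a1` at `5` has `v_T(z₀) ≤ 1` — no door hypothesis
left (it is the theorem `door_389a1_five`). CONDITIONAL on the three named inputs; BSD is not proved by
this. [cite: Kato2004Asterisque, Thm. 16.6 (p. 264)] [cite: BurnsKuriharaSano2019, Lemma 6.12–6.14 (p. 26)]
[cite: Serre1972, §2.8 Prop. 19] -/
theorem firstDerivedKatoClass_389a1_five_of_sandwich [Fact (5 : ℕ).Prime]
    [(c389a1.e.baseChange ℚ).IsElliptic] [(c389a1.e.baseChange ℚ).IsGloballyMinimal]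
    [ContinuousSMul ℤ_[5] ((c389a1.e.baseChange ℚ).tateModule 5)]
    (hSand : (5 ≤ 5 ∧ IsOrdinaryAt (c389a1.e.baseChange ℚ) 5 ∧
        (c389a1.e.baseChange ℚ).HasSurjectiveModNGaloisRep 5) →
      ((∀ {N : ℕ} [NeZero N] (f : CuspForm (Gamma0 N) 2), IsNewformOf (c389a1.e.baseChange ℚ) f →
          (padicLFunction f (unitRoot (c389a1.e.baseChange ℚ) 5 : ℚ_[5])).order ≤ 2) ∧
        (∃ (x : H1 (tateRep (c389a1.e.baseChange ℚ) 5) ⊤) (t : ℚ_[5]),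
          x ∈ integralH1 (tateRep (c389a1.e.baseChange ℚ) 5) 5 ⊤ ∧ t ≠ 0 ∧
          HasLocPKummerLog (c389a1.e.baseChange ℚ) 5 x t)) →
      ∀ (K : ZpExtension ℚ 5) (hK : K.IsCyclotomic) (γ : Field.absoluteGaloisGroup ℚ)
        (I : IwasawaH1Data (c389a1.e.baseChange ℚ) 5 K γ) (z₀ : I.H), K.IsTopGenerator γ →
        IsAdmissibleZetaClass (c389a1.e.baseChange ℚ) 5 K hK I z₀ →
        ¬ ∃ (h : I.H) (m : ℕ), ((5 : IwasawaAlgebra 5) ^ m) • z₀ =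
          ((PowerSeries.X : IwasawaAlgebra 5) ^ 2) • h)
    (hLoc : ∃ (x : H1 (tateRep (c389a1.e.baseChange ℚ) 5) ⊤) (t : ℚ_[5]),
        x ∈ integralH1 (tateRep (c389a1.e.baseChange ℚ) 5) 5 ⊤ ∧ t ≠ 0 ∧
        HasLocPKummerLog (c389a1.e.baseChange ℚ) 5 x t)
    (hdata : ∀ c ∈ c389a1.cells, c.p = 5 → ∀ {N : ℕ} [NeZero N] (f : CuspForm (Gamma0 N) 2),
      IsNewformOf (c389a1.e.baseChange ℚ) f → ∃ D : ℚ, ‖(D : ℚ_[5])‖ = 1 ∧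
        (∀ x : ℚ, ‖(ratPlusSymbol f x : ℚ_[5])‖ ≤ 1) ∧
        ∀ u : ℕ, u < 5 ^ (c.n + 1) → ¬ 5 ∣ u →
          ratPlusSymbol f ((u : ℚ) / (5 : ℚ) ^ (c.n + 1)) = (c.tabHi.getD u 0 : ℚ) / D ∧
          ratPlusSymbol f ((u : ℚ) / (5 : ℚ) ^ c.n) = (c.tabLo.getD (u % 5 ^ c.n) 0 : ℚ) / D)
    (K : ZpExtension ℚ 5) (hK : K.IsCyclotomic) (γ : Field.absoluteGaloisGroup ℚ)
    (I : IwasawaH1Data (c389a1.e.baseChange ℚ) 5 K γ) (z₀ : I.H) (hγ : K.IsTopGenerator γ)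
    (hz : IsAdmissibleZetaClass (c389a1.e.baseChange ℚ) 5 K hK I z₀) :
    ¬ ∃ (h : I.H) (m : ℕ), ((5 : IwasawaAlgebra 5) ^ m) • z₀ =
      ((PowerSeries.X : IwasawaAlgebra 5) ^ 2) • h :=
  rung389a1_five_of_sandwich hSand hLoc hdata door_389a1_five K hK γ I z₀ hγ hz

end Summit.BirchSwinnertonDyer.BirchSwinnertonDyer.Theorems.DerivedKatoValuationDoor

end
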